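import Mathlib.Combinatorics.Hall.Basic
import Mathlib.Data.Fintype.Prod
import Literature.Computability.AlgebraicComplexity.StandardFamilies

/-!
# Route LiftNullstellensatz — `LiftWidthPerFour` (item stmt-ValiantsHypothesis-5922): linear spaces
on the permanental hypersurface, the Hall count

Claim F, combinatorial step: a set `S` of cells of the `n × n` grid meeting every row and every
column whose complement has at most `n + 1` cells (`n ≥ 4`) contains a TRANSVERSAL (an injective
`f` with `(r, f r) ∈ S` for all rows `r`) — Hall's marriage theorem plus the count
`|R| · (n − |N(R)|) ≤ |Sᶜ|`.  For `n = 4`, `|S| = 11`: the 11 leading cells of an 11-dimensional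
space of `4 × 4` matrices either contain a transversal or miss a whole row or a whole column
(`exists_transversal_or_row_or_col`).  No new definitions.
-/

namespace Summit.ValiantsHypothesis.LiftNullstellensatz

open Finset

/-- Hall count: if `S ⊆ [n]×[n]` meets every row and every column and `|Sᶜ| ≤ n + 1` with
`4 ≤ n`, then `S` has a transversal. [folklore] -/
theorem exists_transversal_of_compl_card_le {n : ℕ} (hn : 4 ≤ n) (S : Finset (Fin n × Fin n))
    (hrow : ∀ i, ∃ j, (i, j) ∈ S) (hcol : ∀ j, ∃ i, (i, j) ∈ S) (hcompl : Sᶜ.card ≤ n + 1) :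
    ∃ f : Fin n → Fin n, Function.Injective f ∧ ∀ i, (i, f i) ∈ S := by
  classical
  let t : Fin n → Finset (Fin n) := fun i => univ.filter fun j => (i, j) ∈ S
  have ht : ∀ i j, j ∈ t i ↔ (i, j) ∈ S := fun i j => by simp [t]
  suffices h : ∀ R : Finset (Fin n), R.card ≤ (R.biUnion t).card by
    obtain ⟨f, hf, hft⟩ := (Finset.all_card_le_biUnion_card_iff_exists_injective t).1 h
    exact ⟨f, hf, fun i => (ht i _).1 (hft i)⟩
  intro R
  by_contra hlt
  push Not at hlt
  set N := R.biUnion t with hN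
  -- all cells `R × Nᶜ` lie outside `S`
  have hsub : R ×ˢ Nᶜ ⊆ Sᶜ := by
    intro x hx
    rw [Finset.mem_product] at hx
    rw [Finset.mem_compl]
    intro hxS
    have : x.2 ∈ N := Finset.mem_biUnion.2 ⟨x.1, hx.1, (ht _ _).2 hxS⟩
    exact (Finset.mem_compl.1 hx.2) this
  have hcard : R.card * (n - N.card) ≤ n + 1 := by
    have := Finset.card_le_card hsub
    rw [Finset.card_product, Finset.card_compl, Fintype.card_fin] at this
    exact this.trans hcompl
  have hR : R.card ≤ n := (Finset.card_le_univ R).trans (by rw [Fintype.card_fin])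
  have hNn : N.card ≤ n := (Finset.card_le_univ N).trans (by rw [Fintype.card_fin])
  -- case analysis on |R|
  rcases Nat.lt_or_ge R.card 2 with h1 | h2
  · -- |R| ≤ 1: then |N| = 0 < |R| forces R = {i} with an empty row
    · have hR' : R.card = 1 := by omega
      have hN0 : N.card = 0 := by omega
      obtain ⟨i, hi⟩ := Finset.card_eq_one.1 hR'
      obtain ⟨j, hj⟩ := hrow i
      have : j ∈ N := Finset.mem_biUnion.2 ⟨i, by rw [hi]; exact mem_singleton_self i, (ht _ _).2 hj⟩
      rw [Finset.card_eq_zero] at hN0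
      rw [hN0] at this
      exact Finset.notMem_empty _ this
  · by_cases hRn : R.card = n
    · -- all rows: N misses a column j; but column j meets S
      have hNlt : N.card < n := by omega
      obtain ⟨j, hj⟩ : ∃ j, j ∉ N := by
        by_contra h; push Not at h
        have : N = univ := Finset.eq_univ_iff_forall.2 h
        rw [this, Finset.card_univ, Fintype.card_fin] at hNlt
        exact lt_irrefl _ hNlt
      obtain ⟨i, hi⟩ := hcol j
      have hiR : i ∈ R := by
        have : R = univ := Finset.eq_univ_of_card R (by rw [hRn, Fintype.card_fin])
        rw [this]; exact mem_univ i
      exact hj (Finset.mem_biUnion.2 ⟨i, hiR, (ht _ _).2 hi⟩)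
    · -- 2 ≤ |R| ≤ n - 1 and |N| ≤ |R| - 1: then |R| (n - |N|) ≥ |R| (n + 1 - |R|) ≥ 2 (n - 1) > n + 1
      have hRle : R.card ≤ n - 1 := by omega
      have hNle : N.card ≤ R.card - 1 := by omega
      have h3 : R.card * (n + 1 - R.card) ≤ n + 1 :=
        (Nat.mul_le_mul_left _ (by omega)).trans hcard
      -- f(r) = r (n+1-r) ≥ 2(n-1) for 2 ≤ r ≤ n-1
      have key : 2 * (n - 1) ≤ R.card * (n + 1 - R.card) := by
        have : (R.card - 2) * (n - 1 - R.card) + 2 * (n - 1) = R.card * (n + 1 - R.card) := by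
          zify [hRle, h2, (show R.card ≤ n + 1 by omega), (show 1 ≤ n by omega)]
          ring
        omega
      omega

/-- **Claim F, Hall step (`4 × 4`)**: a set of `11` cells of the `4 × 4` grid without a transversal
misses a whole row or a whole column. [folklore] -/
theorem exists_transversal_or_row_or_col (S : Finset (Fin 4 × Fin 4)) (hS : S.card = 11) :
    (∃ f : Fin 4 → Fin 4, Function.Injective f ∧ ∀ i, (i, f i) ∈ S) ∨
      (∃ i, ∀ j, (i, j) ∉ S) ∨ (∃ j, ∀ i, (i, j) ∉ S) := by
  classical
  by_cases hrow : ∀ i, ∃ j, (i, j) ∈ S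
  · by_cases hcol : ∀ j, ∃ i, (i, j) ∈ S
    · left
      refine exists_transversal_of_compl_card_le (by norm_num) S hrow hcol ?_
      rw [Finset.card_compl, hS, Fintype.card_prod, Fintype.card_fin]
    · push Not at hcol
      exact Or.inr (Or.inr hcol)
  · push Not at hrow
    exact Or.inr (Or.inl hrow)

end Summit.ValiantsHypothesis.LiftNullstellensatz
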